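import Mathlib.Analysis.InnerProductSpace.PiL2
import Mathlib.Analysis.SpecialFunctions.Trigonometric.Angle
import Literature.Probability.LatticeModels.ScalingLimit
import HarnessLib

/-!
# Stub N1a `stub_regularPolygon_mem_nonCoincident` for crux `MoebiusLimitExists` (stmt-CriticalPhenomena-1344), line `Sketch` v20
(lead prover-line-stmt-CriticalPhenomena-1344-c20-0; THEOREM-ONLY, `--supports stmt-CriticalPhenomena-1344`)

The unit regular horizontal `n`-gon `P_n i = cos(2πi/n) e₁ + sin(2πi/n) e₂` of `ℝ³`
(`eₖ = EuclideanSpace.single k 1`) has pairwise distinct vertices, i.e. `i ↦ P_n i` is an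
injective map `Fin n → ℝ³`, i.e. `P_n ∈ NonCoincident 3 n`.

Proof. From `P_n i = P_n j` read off coordinates `1` and `2`: `cos θᵢ = cos θⱼ` and
`sin θᵢ = sin θⱼ` with `θᵢ = 2πi/n`; hence `θᵢ = θⱼ` in `Real.Angle` (`Real.Angle.cos_sin_inj`),
so `2π(i - j)/n = 2πk` for an integer `k` (`Real.Angle.angle_eq_iff_two_pi_dvd_sub`), i.e.
`i - j = n k` with `|i - j| < n`, forcing `i = j` (`Int.eq_zero_of_abs_lt_dvd`). Mathlib only.
-/

open Literature.Probability.LatticeModels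

namespace Summit.CriticalPhenomena.Ising3DConformalLimit.MoebiusLimitExistsSketchV20

/-- The angles `2πi/n`, `i : Fin n`, are pairwise distinct modulo `2π`: if
`cos (2πi/n) = cos (2πj/n)` and `sin (2πi/n) = sin (2πj/n)` then `i = j`
(`Real.Angle.cos_sin_inj`, then `i - j = n k` with `|i - j| < n`). [folklore] -/
private theorem fin_eq_of_cos_eq_of_sin_eq {n : ℕ} {i j : Fin n}
    (hc : Real.cos (2 * Real.pi * ((i : ℕ) : ℝ) / (n : ℝ)) =
      Real.cos (2 * Real.pi * ((j : ℕ) : ℝ) / (n : ℝ)))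
    (hs : Real.sin (2 * Real.pi * ((i : ℕ) : ℝ) / (n : ℝ)) =
      Real.sin (2 * Real.pi * ((j : ℕ) : ℝ) / (n : ℝ))) : i = j := by
  obtain ⟨k, hk⟩ := Real.Angle.angle_eq_iff_two_pi_dvd_sub.1 (Real.Angle.cos_sin_inj hc hs)
  have hn : (0 : ℝ) < n := by exact_mod_cast Fin.pos i
  have hreal : ((i : ℕ) : ℝ) - ((j : ℕ) : ℝ) = (n : ℝ) * (k : ℝ) := by
    have h := hk
    field_simp at h
    nlinarith [Real.pi_pos, h]
  have hint : ((i : ℕ) : ℤ) - ((j : ℕ) : ℤ) = (n : ℤ) * k := by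
    exact_mod_cast hreal
  have hdvd : (n : ℤ) ∣ ((i : ℕ) : ℤ) - ((j : ℕ) : ℤ) := ⟨k, hint⟩
  have habs : |((i : ℕ) : ℤ) - ((j : ℕ) : ℤ)| < (n : ℤ) := by
    rw [abs_sub_lt_iff]
    omega
  have h0 := Int.eq_zero_of_abs_lt_dvd hdvd habs
  exact Fin.ext (by omega)

/-- **Stub N1a.** The unit regular horizontal `n`-gon `P_n i = cos(2πi/n) e₁ + sin(2πi/n) e₂`
(`eₖ = EuclideanSpace.single k 1 : EuclideanSpace ℝ (Fin 3)`) has pairwise distinct vertices: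
`i ↦ P_n i` is injective on `Fin n`, i.e. `P_n ∈ NonCoincident 3 n` (read coordinates `1`, `2`
and use that `i ↦ 2πi/n` is injective modulo `2π` on `Fin n`). [folklore] -/
theorem stub_regularPolygon_mem_nonCoincident : ∀ n : ℕ,
    (fun i : Fin n => Real.cos (2 * Real.pi * ((i : ℕ) : ℝ) / (n : ℝ)) • (EuclideanSpace.single 1 1 : EuclideanSpace ℝ (Fin 3)) +
      Real.sin (2 * Real.pi * ((i : ℕ) : ℝ) / (n : ℝ)) • (EuclideanSpace.single 2 1 : EuclideanSpace ℝ (Fin 3))) ∈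
      NonCoincident 3 n := by
  intro n
  rw [mem_nonCoincident]
  intro i j hij
  have h1 := congrArg (fun u : EuclideanSpace ℝ (Fin 3) => u 1) hij
  have h2 := congrArg (fun u : EuclideanSpace ℝ (Fin 3) => u 2) hij
  have h12 : (1 : Fin 3) ≠ 2 := by decide
  have h21 : (2 : Fin 3) ≠ 1 := by decide
  simp only [PiLp.add_apply, PiLp.smul_apply, PiLp.single_apply, smul_eq_mul, mul_one, mul_zero,
    h12, h21, if_true, if_false, add_zero, zero_add] at h1 h2
  exact fin_eq_of_cos_eq_of_sin_eq h1 h2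

end Summit.CriticalPhenomena.Ising3DConformalLimit.MoebiusLimitExistsSketchV20
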